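import Summits.MatrixMultiplication.MatrixMultiplication.Theses.DefinableSTPPDichotomy
import Summits.MatrixMultiplication.MatrixMultiplication.Theses.EisensteinValCertificates
import Literature.Combinatorics.Additive.TightTriangleRemovalProofs

/-!
# `ExactDefinableDesign` is killed by `NoHomocyclicSTPP` (cross-route negative lemma)

Negative lemma for the TARGET `ExactDefinableDesign` (stmt-MatrixMultiplication-18073) of route
`MatrixMultiplication/DefinableSTPPDichotomy`, recorded by its target-vetting refuter: the negative
milestone `NoHomocyclicSTPP` (stmt-MatrixMultiplication-7787, route `EisensteinValCertificates`:
some `ε > 0` such that NO STPP family in any `(ℤ/q)^ℓ`, `q` a prime power, has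
`Σ_i (|A_i||B_i||C_i|)^{(2+ε)/3} > q^ℓ`) refutes the target outright — for EVERY finite field `F`
(prime or prime-power order, any characteristic `p`) the host `F^m` is additively `(ℤ/p)^{ℓ}` with
`p^ℓ = |F|^m` (a `ℤ/p`-linear isomorphism, `Module.finrank` bookkeeping), the element-indexed STPP
clause re-indexed by `Fin |I|` is the tree's `IsSTPP`, and `IsSTPP` transports along injective additive
maps (`IsSTPP.image`).  Hence `ExactDefinableDesign → HomocyclicSTPPDesigns` (the other route's target)
and a proof of `NoHomocyclicSTPP` closes BOTH routes refuted.  This is an implication between two OPEN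
statements: it changes no verdict (the target was stamped `survives`); it is the formal form of the
route's kill criterion "PrimeValConjecture ⇒ … restrict to prime powers or close" — note that prime-power
FIELDS do NOT escape `NoHomocyclicSTPP` (their additive groups are elementary abelian).
-/

namespace Summit.MatrixMultiplication.MatrixMultiplication.Theorems

open Literature.Computability.AlgebraicComplexity
open Summit.MatrixMultiplication.MatrixMultiplication.Theses

/-- `NoHomocyclicSTPP → ¬ ExactDefinableDesign`: an exact definable STPP design in bounded rank over
finite fields would in particular be an STPP family in the elementary abelian group
`(F, +)^m ≅ (ℤ/p)^ℓ`, `p = char F`, `p^ℓ = |F|^m`, beating `p^ℓ` at every exponent `(2+ε)/3` — exactly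
what `NoHomocyclicSTPP` forbids at its own `ε`. [folklore] -/
theorem ExactDefinableDesign_false_of_NoHomocyclicSTPP
    (h : EisensteinValCertificates.NoHomocyclicSTPP) :
    ¬ DefinableSTPPDichotomy.ExactDefinableDesign := by
  classical
  rintro ⟨e, m, k, φI, φA, φB, φC, hfam⟩
  obtain ⟨ε, hε, hno⟩ := h
  obtain ⟨F, instF, instFin, instCR, -, y, I, A, B, C, -, -, -, -, hSTPP, hmass⟩ := hfam ε hε 0
  -- the characteristic `p` of `F` is prime and `F^m` is a finite free `ℤ/p`-module
  obtain ⟨p, hchar⟩ := CharP.exists F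
  have hp : p.Prime := CharP.char_is_prime F p
  haveI : Fact p.Prime := ⟨hp⟩
  letI : Algebra (ZMod p) F := ZMod.algebra F p
  set ℓ := Module.finrank (ZMod p) (Fin m → F) with hℓ
  have hrank : Module.finrank (ZMod p) (Fin m → F) = Module.finrank (ZMod p) (Fin ℓ → ZMod p) := by
    rw [Module.finrank_fin_fun]
  set eqv := LinearEquiv.ofFinrankEq _ _ hrank with heqv
  have hinj : Function.Injective eqv := eqv.injective
  -- cardinalities: `|F|^m = p^ℓ`
  have hcardNat : Fintype.card F ^ m = p ^ ℓ := by
    have h1 : Fintype.card (Fin m → F) = Fintype.card (Fin ℓ → ZMod p) :=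
      Fintype.card_congr eqv.toEquiv
    simpa [Fintype.card_fun, Fintype.card_fin, ZMod.card] using h1
  have hcard : (Fintype.card F : ℝ) ^ (m : ℝ) = (p : ℝ) ^ ℓ := by
    rw [Real.rpow_natCast]
    exact_mod_cast hcardNat
  -- re-index the element-indexed clause by `Fin |I|`
  set N := I.card with hN
  let ι : Fin N → (Fin e → F) := fun i => (I.equivFin.symm i : Fin e → F)
  have hιmem : ∀ i, ι i ∈ I := fun i => (I.equivFin.symm i).2
  have hιinj : Function.Injective ι := fun i j hij =>
    I.equivFin.symm.injective (Subtype.ext hij)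
  have hST : IsSTPP (fun i => A (ι i)) (fun i => B (ι i)) (fun i => C (ι i)) := by
    intro i j l s hs s' hs' t ht t' ht' u hu u' hu' hsum
    obtain ⟨hij, hjl, hss, htt, huu⟩ := hSTPP (ι i) (hιmem i) (ι j) (hιmem j) (ι l) (hιmem l)
      s hs s' hs' t ht t' ht' u hu u' hu' hsum
    exact ⟨hιinj hij, hιinj hjl, hss, htt, huu⟩
  -- transport to `(ℤ/p)^ℓ` and apply the milestone
  have hST' := hST.image eqv hinj
  have hmain := hno p ℓ hp.isPrimePow N _ _ _ hST'
  simp only [Finset.card_image_of_injective _ hinj] at hmain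
  have hsum : ∑ x ∈ I, (((A x).card * (B x).card * (C x).card : ℕ) : ℝ) ^ ((2 + ε) / 3) =
      ∑ i : Fin N, (((A (ι i)).card * (B (ι i)).card * (C (ι i)).card : ℕ) : ℝ) ^ ((2 + ε) / 3) := by
    rw [← Finset.sum_coe_sort I]
    exact Fintype.sum_equiv I.equivFin _ _ (fun x => by simp [ι])
  have hle : ∑ x ∈ I, (((A x).card * (B x).card * (C x).card : ℕ) : ℝ) ^ ((2 + ε) / 3) ≤
      (Fintype.card F : ℝ) ^ (m : ℝ) := by
    rw [hsum, hcard]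
    exact hmain
  exact absurd hmass (not_lt.2 hle)

end Summit.MatrixMultiplication.MatrixMultiplication.Theorems
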